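import Mathlib
import Summits.NavierStokesRegularity.NavierStokesRegularity.Theses.EfficiencyFloor
import HarnessLib

/-!
# `EfficiencyFloor.FloorOfEfficiencyDecay` (item stmt-NavierStokesRegularity-22868): the SUPER-LERAY
# floor from production-efficiency decay and enstrophy divergence (real analysis)

**Statement (the route decl, verbatim).** `ProductionEfficiencyDecay → BlowupEnstrophyUnbounded →`
for every maximal smooth Leray–Hopf rapidly-decaying-datum solution on `[0,T)` and every `K`,
eventually as `t ↑ T`: `K/√(T−t) < Z(t) = ∫|curl u(t)|²`.

PROOF (the item card). Given `K`, take `ε := 1/(K² + 1)`; `ProductionEfficiencyDecay` gives an onset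
`t₁` with `0 < Z < ∞` on `[t₁,T)` and `Z(s)⁻² − Z(t)⁻² ≤ ε (t − s)` for `t₁ ≤ s ≤ t < T` (real
values via `toReal`). Fix `s ∈ [t₁,T)`; by `BlowupEnstrophyUnbounded`, for every `N > 0` some
`t ∈ (s,T)` has `Z(t) ≥ N`, so `Z(s)⁻² ≤ ε(T−s) + N⁻²`; letting `N → ∞`, `Z(s)⁻² ≤ ε(T−s)`, i.e.
`Z(s)² ≥ (K²+1)/(T−s) > K²/(T−s)`, hence `Z(s) > K/√(T−s)`; and `[t₁,T) ∈ 𝓝[<] T`.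

HONEST FRAMING: bookkeeping about a HYPOTHETICAL blow-up under two HYPOTHESES (the crux
`ProductionEfficiencyDecay` and the support `BlowupEnstrophyUnbounded`); nothing about NS regularity
is asserted. [folklore]
-/

noncomputable section

open Set Filter Topology MeasureTheory
open scoped ENNReal NNReal
open Literature.Analysis.FluidPDE

namespace Summit.NavierStokesRegularity.NavierStokesRegularity.Theorems

-- the problem directory repeats the summit name (`NavierStokesRegularity/NavierStokesRegularity`)
set_option linter.dupNamespace false

namespace FloorOfEfficiencyDecay

/-- The real-analysis core: a positive finite quantity `Z` on `[t₁,T)` with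
`Z(s)⁻² − Z(t)⁻² ≤ ε(t−s)` (`t₁ ≤ s ≤ t < T`) and `Z(t) → ∞` as `t ↑ T` (every level `N` is reached
at times arbitrarily close to `T`, after any `s < T`) satisfies `Z(s)⁻² ≤ ε(T−s)` on `[t₁,T)`.
[folklore] -/
theorem inv_sq_le {T t₁ ε : ℝ} {Z : ℝ → ℝ} (hε : 0 ≤ ε)
    (hdec : ∀ s t : ℝ, t₁ ≤ s → s ≤ t → t < T → (Z s)⁻¹ ^ 2 - (Z t)⁻¹ ^ 2 ≤ ε * (t - s))
    (hunb : ∀ s < T, ∀ N : ℝ, ∃ t ∈ Ioo s T, N ≤ Z t)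
    {s : ℝ} (hs : s ∈ Ico t₁ T) : (Z s)⁻¹ ^ 2 ≤ ε * (T - s) := by
  refine le_of_forall_pos_lt_add fun δ hδ => ?_
  -- a level `N ≥ 1` with `N⁻¹ < δ`
  set N : ℝ := max 1 (2 / δ) with hN
  have hN1 : 1 ≤ N := le_max_left _ _
  have hNpos : 0 < N := one_pos.trans_le hN1
  have hNδ : N⁻¹ ^ 2 < δ := by
    have h1 : N⁻¹ ≤ δ / 2 := by
      rw [inv_le_comm₀ hNpos (by positivity)]
      have : 2 / δ ≤ N := le_max_right _ _
      rw [show (δ / 2)⁻¹ = 2 / δ by rw [inv_div]]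
      exact this
    have h2 : N⁻¹ ^ 2 ≤ N⁻¹ := by
      have h3 : N⁻¹ ≤ 1 := inv_le_one_of_one_le₀ hN1
      have h4 : 0 ≤ N⁻¹ := inv_nonneg.2 hNpos.le
      nlinarith
    linarith
  obtain ⟨t, ht, hNt⟩ := hunb s hs.2 N
  have hZt : 0 < Z t := hNpos.trans_le hNt
  have h1 := hdec s t hs.1 ht.1.le ht.2
  have h2 : (Z t)⁻¹ ^ 2 ≤ N⁻¹ ^ 2 := by
    have : (Z t)⁻¹ ≤ N⁻¹ := (inv_le_inv₀ hZt hNpos).2 hNt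
    exact pow_le_pow_left₀ (inv_nonneg.2 hZt.le) this 2
  have h3 : ε * (t - s) ≤ ε * (T - s) := mul_le_mul_of_nonneg_left (by linarith [ht.2]) hε
  linarith

/-- From `Z(s)⁻² ≤ ε(T−s)` with `ε = 1/(K²+1)`, `Z(s) > 0`, `s < T`: `K/√(T−s) < Z(s)`. [folklore] -/
theorem floor_of_inv_sq_le {T K s z : ℝ} (hz : 0 < z) (hs : s < T)
    (h : z⁻¹ ^ 2 ≤ 1 / (K ^ 2 + 1) * (T - s)) : K / Real.sqrt (T - s) < z := by
  have hTs : 0 < T - s := sub_pos.2 hs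
  have hsq : 0 < Real.sqrt (T - s) := Real.sqrt_pos.2 hTs
  have hK1 : 0 < K ^ 2 + 1 := by positivity
  -- `z² ≥ (K²+1)/(T−s)`
  have hz2 : (K ^ 2 + 1) / (T - s) ≤ z ^ 2 := by
    have h1 : (z ^ 2)⁻¹ ≤ 1 / (K ^ 2 + 1) * (T - s) := by rwa [inv_pow] at h
    have h2 : 0 < 1 / (K ^ 2 + 1) * (T - s) := by positivity
    have h3 := (inv_le_comm₀ (pow_pos hz 2) h2).1 h1
    rwa [mul_inv, one_div, inv_inv, ← div_eq_mul_inv] at h3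
  by_cases hK : K ≤ 0
  · exact lt_of_le_of_lt (div_nonpos_of_nonpos_of_nonneg hK hsq.le) hz
  rw [not_le] at hK
  have hlt : (K / Real.sqrt (T - s)) ^ 2 < z ^ 2 := by
    rw [div_pow, Real.sq_sqrt hTs.le]
    exact lt_of_lt_of_le (div_lt_div_of_pos_right (by linarith) hTs) hz2
  exact lt_of_pow_lt_pow_left₀ 2 hz.le hlt

/-- **The super-Leray floor** (the item's content). [folklore] -/
theorem main
    (hE : Summit.NavierStokesRegularity.NavierStokesRegularity.Theses.EfficiencyFloor.ProductionEfficiencyDecay)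
    (hU : Summit.NavierStokesRegularity.NavierStokesRegularity.Theses.EfficiencyFloor.BlowupEnstrophyUnbounded)
    {ν T : ℝ} (hν : 0 < ν) (hT : 0 < T)
    {u : ℝ → EuclideanSpace ℝ (Fin 3) → EuclideanSpace ℝ (Fin 3)}
    {p : ℝ → EuclideanSpace ℝ (Fin 3) → ℝ}
    (hmax : IsMaximalSmoothSolution ν 0 u p T) (hLH : IsLerayHopfOn T ν 0 (u 0) u)
    (hdec : HasRapidSpatialDecay (u 0)) (K : ℝ) :
    ∀ᶠ t in 𝓝[<] T, ENNReal.ofReal (K / Real.sqrt (T - t)) < ∫⁻ x, ‖curl (u t) x‖ₑ ^ 2 := by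
  set ε : ℝ := 1 / (K ^ 2 + 1) with hεdef
  have hε : 0 < ε := by positivity
  obtain ⟨t₁, ht₁, hwin, hdecay⟩ := hE ν T hν hT u p hmax hLH hdec ε hε
  set Z : ℝ → ℝ := fun t => (∫⁻ x, ‖curl (u t) x‖ₑ ^ 2).toReal with hZ
  -- every level is reached after every `s < T`
  have hunb : ∀ s < T, ∀ N : ℝ, ∃ t ∈ Ioo s T, N ≤ Z t := by
    intro s hs N
    have h1 := hU ν T hν hT u p hmax hLH hdec (max N 0)
    have h2 : ∀ᶠ t in 𝓝[<] T, t ∈ Ioo (max s t₁) T := Ioo_mem_nhdsLT (max_lt hs ht₁.2)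
    obtain ⟨t, hNt, ht⟩ := (h1.and h2).exists
    have htI : t ∈ Ico t₁ T := ⟨(le_max_right _ _).trans ht.1.le, ht.2⟩
    have htop : ∫⁻ x, ‖curl (u t) x‖ₑ ^ 2 ≠ ⊤ := (hwin t htI).2.ne
    refine ⟨t, ⟨(le_max_left _ _).trans_lt ht.1, ht.2⟩, ?_⟩
    have h3 : max N 0 ≤ Z t := (ENNReal.ofReal_le_iff_le_toReal htop).1 hNt
    exact (le_max_left _ _).trans h3
  have hdec' : ∀ s t : ℝ, t₁ ≤ s → s ≤ t → t < T → (Z s)⁻¹ ^ 2 - (Z t)⁻¹ ^ 2 ≤ ε * (t - s) :=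
    fun s t h1 h2 h3 => hdecay s t h1 h2 h3
  have hIco : ∀ᶠ t in 𝓝[<] T, t ∈ Ico t₁ T := Ico_mem_nhdsLT ht₁.2
  filter_upwards [hIco] with s hs
  have hpos := (hwin s hs).1
  have htop := (hwin s hs).2
  have hZs : 0 < Z s := ENNReal.toReal_pos hpos.ne' htop.ne
  have hinv := inv_sq_le hε.le hdec' hunb hs
  have hfloor : K / Real.sqrt (T - s) < Z s := floor_of_inv_sq_le hZs hs.2 hinv
  calc ENNReal.ofReal (K / Real.sqrt (T - s)) < ENNReal.ofReal (Z s) :=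
        (ENNReal.ofReal_lt_ofReal_iff hZs).2 hfloor
    _ = ∫⁻ x, ‖curl (u s) x‖ₑ ^ 2 := ENNReal.ofReal_toReal htop.ne

end FloorOfEfficiencyDecay

open FloorOfEfficiencyDecay in
/-- **Item stmt-NavierStokesRegularity-22868** (`EfficiencyFloor.FloorOfEfficiencyDecay`):
`ProductionEfficiencyDecay` and `BlowupEnstrophyUnbounded` give the super-Leray floor
`K/√(T−t) < Z(t)` eventually, for every `K`, along every maximal Leray–Hopf rapidly-decaying-datum
solution of finite lifespan. Bookkeeping under two hypotheses; nothing about NS regularity is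
asserted. [folklore] -/
theorem efficiencyFloor_floorOfEfficiencyDecay_proof :
    Summit.NavierStokesRegularity.NavierStokesRegularity.Theses.EfficiencyFloor.FloorOfEfficiencyDecay := by
  unfold Summit.NavierStokesRegularity.NavierStokesRegularity.Theses.EfficiencyFloor.FloorOfEfficiencyDecay
  intro hE hU ν T hν hT u p hmax hLH hdec K
  exact main hE hU hν hT hmax hLH hdec K

end Summit.NavierStokesRegularity.NavierStokesRegularity.Theorems

end
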